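import Literature.Geometry.Kaehler.ComplexTorusEquivariantEndomorphismAlgebraCommutantCyclicFixedPoints
import Literature.Geometry.Kaehler.ComplexTorusEquivariantEndomorphismAlgebraCommutantDecomposition
import Literature.LinearAlgebra.TateCommutantDimension
import HarnessLib

/-!
# The rational representation of an endomorphism of finite order in full: `P^r_u = Π_{d ∣ n} Φ_d^{h_d}`,
# `dim_ℚ C(u) = Σ_{d ∣ n} φ(d) h_d²` (Tate's `r(P^r_u)`), and `#X^δ = Π_{d ∈ D} Φ_d(1)^{h_d} = Π_{ℓ^j ∈ D} ℓ^{h_{ℓ^j}}`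

Layer `Literature/Geometry/Kaehler`, namespace `Literature.Geometry.Kaehler.ComplexTorus` (§1 in
`Literature.Geometry.Kaehler.CyclotomicIdempotents`); lane `lit-hodgefound` (Track 2 foundations library), Layer
A2, row «A2-26(fb)» (self-proposed 2026-08-28, prover seat `lit-hodgefound-p10`, generation 28, FILE 3).  For
`u ∈ End_ℚ(X)` with `uⁿ = 1` generation 7 defined the cyclotomic idempotents `e_d(u)`, `d ∣ n`, the components
`X^{e_d}` and the MULTIPLICITIES `h_d = rk Λ(X^{e_d})/φ(d)` (`cyclicMultiplicity`, Lange–Rodríguez's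
`ρ_r = Σ_d h_d W_d`) with `P(u|X^{e_d}) = Φ_d^{h_d}` component by component and `Σ_d φ(d) h_d = 2 dim X`; generation
27 FILE 2 treated the SQUAREFREE case `h_d ≤ 1` (`P^r_u = Π_{d ∈ D} Φ_d`), FILE 5 its fixed points, and seat p11
the ONE-FACTOR case `Φ_ℓ(δ) = 0` (`#A^δ = ℓ^{2g/(ℓ−1)}`).  THIS FILE assembles the global statements for an
ARBITRARY endomorphism of finite order through the tree's Tate–Milne commutant count
(`Literature.LinearAlgebra.TateCommutantDimension`: `V = ⊕_P ker P(γ)`, `P_γ = Π P^{d_P}`, `dim End_{k[γ]}(V) = r(P_γ)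
= Σ_P d_P² deg P`): **(i)** `ker Φ_d(ρ_r(u)) = Im e_d(u)` on `H₁(X, ℚ)`, of dimension `φ(d) h_d`; **(ii)**
`P^r_u = Π_{d ∣ n} Φ_d^{h_d} = Π_{d ∈ D} Φ_d^{h_d}`; **(iii)** `dim_ℚ C(u) = Σ_{d ∣ n} φ(d) h_d²` — Dolgachev–Zarhin's
Remark 2.17 («`End_ℚ(A)_δ ↪ End_{ℚ[δ]}(Λ_ℚ) = Mat_r(ℚ[δ])`, `d ≤ r²`») for every finite order at once, with the
generation-26/27 criterion recovered as `dim C(u) = 2 dim X ⟺ P^r_u` squarefree; **(iv)** for an automorphism `δ`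
with `ρ_r(δ) ⊗ 1 = u`: `#X^δ = |P^r_u(1)| = Π_{d ∈ D} Φ_d(1)^{h_d} = Π_{ℓ^j ∈ D} ℓ^{h_{ℓ^j}}` when `1 ∉ D` (and `0`,
i.e. infinite, when `1 ∈ D`).  CONSUMED BY NAME, nothing restated: `Literature.LinearAlgebra.isInternal_ker_aeval` /
`charpoly_eq_prod_charpoly_restrict` / `mapsTo_ker_aeval` / `aeval_restrict_ker_eq_zero` /
`exists_finrank_charpoly_centralizer_of_irreducible` / `finrank_centralizer_eq_tateR_of_charpoly_eq` / `tateR_finset_prod_pow` /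
`finrank_le_finrank_centralizer` / `finrank_centralizer_eq_finrank_iff` (Tate 1966 / Milne §7), generation 7's
`cyclicIdempotent` / `cycIdem` / `cyclotomic_dvd_cycIdem` / `sum_cyclicIdempotent` / `aeval_cyclotomic_mul_cyclicIdempotent` /
`isIdempotentElem_cyclicIdempotent` / `cyclicMultiplicity` / `subRank_cyclicIdempotent_eq_totient_mul`, generation 26's
`subRank_idemSubspace_eq_finrank_range` (`…CommutantDecomposition`), FILE 2's `mem_eigenvalueOrders_iff_cyclotomic_dvd_charpoly` /
`cyclicMultiplicity_ne_zero_iff_mem_eigenvalueOrders` / `squarefree_charpoly_coe_iff_forall_cyclicMultiplicity_le_one`, FILE 4's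
`three_le_of_mem_eigenvalueOrders…` reading `Φ_d(1)`, seat p11's `fixedSubgroup` / `natCard_fixedSubgroup`, FILE 3's `gaussSq` lemmas,
and Mathlib's `Module.End.isSemisimple_of_squarefree_aeval_eq_zero` / `eval_one_cyclotomic_prime_pow`.  Theorems only; NO
definition, NO named fact (D-0026, net debt 0).

## The print

* J. Tate, *Endomorphisms of abelian varieties over finite fields*, Invent. Math. 2 (1966), p. 138, and J. S. Milne,
  *Abelian varieties* (course notes), §7 p. 74–75: «Let `f(t) = Π P(t)^{m(P)}` […] `r(f) = Σ m(P)² deg P` […] if a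
  semisimple endomorphism `γ` of `V` has characteristic polynomial `f`, then `dim_k End_{k[γ]}(V) = r(f)`» — the
  tree's `tateR`, `finrank_centralizer_eq_tateR_charpoly`.
* I. Dolgachev, Yu. G. Zarhin, *Endomorphisms of Complex Abelian Varieties* (2024; held
  `paper:galaxy-pdf-8712177384607648460`), §2.2 Remark 2.17 (p0035), VERBATIM: «we have a natural embedding
  `End(A)_δ ↪ End_{ℤ[δ]}(Λ)`. Tensoring by `ℚ` we get an embedding `End_ℚ(A)_δ ↪ End_{ℚ[δ]}(Λ_ℚ)`. Since `Λ_ℚ` is a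
  free module of rank `r` over the field `ℚ[δ] ≅ ℚ(ζ_ℓ)`, we obtain the inequality `d ≤ r²`»; Thm. 2.18 (p0036);
  (2.15)–(2.17) (p0033–p0034): «`A^δ ≅ Λ/(1 − δ)Λ` […] `#A^δ = ℓ^{2 dim A/(ℓ−1)}`».  Here `ℚ[δ]` need not be a field:
  `Λ_ℚ = ⊕_d (ℚ(ζ_d))^{h_d}` and `End_{ℚ[δ]}(Λ_ℚ) = Π_d Mat_{h_d}(ℚ(ζ_d))`, of dimension `Σ_d φ(d) h_d²`.
* H. Lange, R. E. Rodríguez, *Decomposition of Jacobians by Prym Varieties*, LNM 2310 (2022), §2.9 Prop. 2.9.3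
  (p0046: «`ρ_r = Σ_j h_j W_j`», `dim A_j = ½ h_j [L_j : ℚ] dim V_j`), §6.1.1 Prop. 6.1.2 (p0153: the `W_d`, `d ∣ n`).
* M. Alvarado, R. Auffarth, *Fixed points of endomorphisms of complex tori*, J. Algebra 507 (2018), §3 (p0006):
  «`F(n) = Δ_n(χ^r_f)`», `Δ_n(Q) := Π (α_iⁿ − 1)` — `#Fix = |P^r(1)|` in general.
* H. Lange, Ch. Birkenhake, *Complex Abelian Varieties* (1992), Ch. 13 §1 (holomorphic Lefschetz fixed-point formula).

## What is proved (`X = E/Φ(ℤ^ι)`, `u ∈ End_ℚ(X) = endAlgRat Φ ⊆ M_ι(ℚ)`, `uⁿ = 1`, `n > 0`, `e_d = cyclicIdempotent n u d`,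
`h_d = cyclicMultiplicity Φ n u d`, `D = eigenvalueOrders n u`, `γ = toLin' u` on `H₁(X, ℚ) = ℚ^ι`, `C(u) = centralizer ℚ {u}`)

* §1 (`CyclotomicIdempotents`, any `ℚ`-vector space `V`, `γ ∈ End V`, `γⁿ = 1`):
  **`ker_aeval_cyclotomic_eq_range_cyclicIdempotent`** (`ker Φ_d(γ) = Im e_d(γ)`), `isSemisimple_of_pow_eq_one'`
  (`γ` semisimple: `q_γ ∣ xⁿ − 1` squarefree), `finrank_centralizer_matrix_eq_toLin'` (`dim C(A) = dim C(toLin' A)`).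
* §2 (torus) `toLin'_cyclicIdempotent`, **`finrank_range_cyclicIdempotent_eq`** / **`finrank_ker_aeval_cyclotomic_eq`**
  (`dim Im e_d = dim ker Φ_d(ρ_r(u)) = φ(d) h_d`), **`charpoly_coe_eq_prod_cyclotomic_pow`** (`P^r_u = Π_{d ∣ n} Φ_d^{h_d}`),
  `charpoly_coe_eq_prod_cyclotomic_pow_eigenvalueOrders` (`= Π_{d ∈ D} Φ_d^{h_d}`),
  `cyclicMultiplicity_eq_zero_iff_not_mem` / `mem_eigenvalueOrders_iff_cyclicMultiplicity_pos`.
* §3 THE COMMUTANT: **`finrank_centralizer_coe_eq_sum_sq`** (`dim_ℚ C(u) = Σ_{d ∣ n} φ(d) h_d²`, Tate's `r(P^r_u)`),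
  `finrank_centralizer_coe_eq_sum_sq_eigenvalueOrders`, `card_le_finrank_centralizer_coe` (`2 dim X ≤ dim C(u)`),
  `finrank_centralizer_coe_le_card_sq`, **`finrank_centralizer_coe_eq_card_iff_squarefree`** (`dim C(u) = 2 dim X ⟺ P^r_u`
  squarefree `⟺ ∀ h_d ≤ 1`), `finrank_endAlgRat_inf_centralizer_le` (`dim (End_ℚ(X) ∩ C(u)) ≤ Σ φ(d) h_d²` — the
  `u`-equivariant endomorphisms, Dolgachev–Zarhin's `d ≤ r²`).
* §4 FIXED POINTS IN GENERAL (`u = D_ℚ`, `δ = ρ(D)` an endomorphism with `δⁿ` an isogeny-identity):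
  **`intCast_natCard_fixedSubgroup_eq_abs_prod`** (`#X^δ = |Π_{d ∣ n} Φ_d(1)^{h_d}|` in `ℤ`),
  **`natCard_fixedSubgroup_eq_zero_iff_one_mem`** (`#X^δ = 0 ⟺ 1 ∈ D`), and for `1 ∉ D`:
  **`natCard_fixedSubgroup_eq_prod_pow`** (`#X^δ = Π_{d ∈ D} Φ_d(1)^{h_d}`),
  **`natCard_fixedSubgroup_eq_prod_minFac_pow`** (`= Π_{d ∈ D prime power} ℓ_d^{h_d}`), `prime_dvd_natCard_fixedSubgroup_iff'`
  (`ℓ ∣ #X^δ ⟺ ℓ^j ∈ D` for some `j ≥ 1`).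
* §5 INSTANCES: `E_i × E_i` with `(i, i)` (`D = {4}`, `h_4 = 2`): `eigenvalueOrders_gaussSq`, **`cyclicMultiplicity_gaussSq_four`**
  (`h_4 = 2`), `charpoly_gaussSq_eq_cyclotomic_sq` (`P^r = Φ_4²` re-derived from §2), **`finrank_centralizer_gaussSq`**
  (`dim C(i, i) = φ(4)·2² = 8 = dim_ℚ M₂(ℚ(i))`), **`natCard_fixedSubgroup_gaussSq`** (`#Fix(i, i) = Φ_4(1)² = 4`).

## References

* [Tate1966Endomorphisms] J. Tate, *Endomorphisms of abelian varieties over finite fields*, Invent. Math. 2 (1966)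
  134–144, p. 138.
* [Milne1999] J. S. Milne, *Abelian Varieties*, §7 pp. 74–75.
* [DolgachevZarhin2024] I. Dolgachev, Yu. G. Zarhin, *Endomorphisms of Complex Abelian Varieties* (2024), §2.2
  Remark 2.17, Thm. 2.18, (2.15)–(2.17).
* [LangeRodriguez2022] H. Lange, R. E. Rodríguez, *Decomposition of Jacobians by Prym Varieties*, LNM 2310 (2022),
  §2.9 Prop. 2.9.3, §6.1.1 Prop. 6.1.2.
* [AlvaradoAuffarth2018] M. Alvarado, R. Auffarth, J. Algebra 507 (2018), §3.
* [LangeBirkenhake1992] H. Lange, Ch. Birkenhake, *Complex Abelian Varieties* (1992), Ch. 13 §1.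
* [CaroccaLangeRodriguez2019] A. Carocca, H. Lange, R. E. Rodríguez, Arch. Math. 112 (2019), §2.2.
-/

noncomputable section

open Module Function Polynomial Finset
open scoped Matrix

namespace Literature.Geometry.Kaehler

/-! ### §1 Linear algebra of an operator of finite order over `ℚ` -/

namespace CyclotomicIdempotents

section Operator

variable {V : Type*} [AddCommGroup V] [Module ℚ V] {n : ℕ} {γ : Module.End ℚ V}

/-- **`ker Φ_d(γ) = Im e_d(γ)`** for `γⁿ = 1`, `d ∣ n`: the cyclotomic idempotent `e_d(γ) = E_{n,d}(γ)` projects ONTO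
the kernel of `Φ_d(γ)` (`Φ_d E_{n,d} ≡ 0`, and `Φ_d ∣ E_{n,m}` for `m ≠ d`, so `x = Σ_m e_m x = e_d x` on `ker Φ_d(γ)`).
[cite: LangeRodriguez2022, §2.9 (before Thm. 2.9.1: «`G` acts on `A^{e_i}` by a multiple of `W_i`»), p0043] -/
theorem ker_aeval_cyclotomic_eq_range_cyclicIdempotent (hn : 0 < n) (hγ : γ ^ n = 1) {d : ℕ} (hd : d ∈ n.divisors) :
    LinearMap.ker (aeval γ (cyclotomic d ℚ)) = LinearMap.range (cyclicIdempotent n γ d) := by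
  apply le_antisymm
  · intro x hx
    rw [LinearMap.mem_ker] at hx
    have hsum : x = ∑ m ∈ n.divisors, cyclicIdempotent n γ m x := by
      rw [← LinearMap.sum_apply, sum_cyclicIdempotent hn hγ, Module.End.one_apply]
    have hzero : ∀ m ∈ n.divisors, m ≠ d → cyclicIdempotent n γ m x = 0 := by
      intro m hm hmd
      obtain ⟨c, hc⟩ := cyclotomic_dvd_cycIdem hd hmd.symm
      rw [cyclicIdempotent, hc, mul_comm, map_mul, Module.End.mul_apply, hx, map_zero]
    rw [Finset.sum_eq_single_of_mem d hd (fun m hm hmd ↦ hzero m hm hmd)] at hsum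
    rw [hsum]
    exact LinearMap.mem_range_self _ x
  · rintro _ ⟨y, rfl⟩
    rw [LinearMap.mem_ker, ← Module.End.mul_apply, aeval_cyclotomic_mul_cyclicIdempotent hn hγ hd,
      LinearMap.zero_apply]

/-- An operator of finite order over `ℚ` is semisimple (`q_γ ∣ xⁿ − 1`, squarefree). [cite: Milne1999, §7 p. 75 («semisimple endomorphism»)] -/
theorem isSemisimple_of_pow_eq_one' (hn : 0 < n) (hγ : γ ^ n = 1) : γ.IsSemisimple :=
  Module.End.isSemisimple_of_squarefree_aeval_eq_zero
    (X_pow_sub_one_separable_iff.2 (Nat.cast_ne_zero.2 hn.ne')).squarefree (by simp [hγ])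

/-- **`P_γ = Π_{d ∣ n} Φ_d^{dim ker Φ_d(γ) / φ(d)}`** for `γⁿ = 1` on a finite-dimensional `ℚ`-space: `V = ⊕_{d ∣ n} ker Φ_d(γ)`
(the `Φ_d` are pairwise coprime with product `xⁿ − 1`) and `γ|ker Φ_d(γ)` has characteristic polynomial `Φ_d^{m_d}`,
`m_d φ(d) = dim ker Φ_d(γ)` (Tate's `P`-isotypic block). [cite: Milne1999, §7 p. 75 («`f(t) = Π P(t)^{m(P)}`»)] [cite: Tate1966Endomorphisms, p. 138] -/
theorem charpoly_eq_prod_cyclotomic_pow_finrank_div [FiniteDimensional ℚ V] (hn : 0 < n) (hγ : γ ^ n = 1) :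
    γ.charpoly = ∏ d ∈ n.divisors,
      cyclotomic d ℚ ^ (finrank ℚ (LinearMap.ker (aeval γ (cyclotomic d ℚ))) / Nat.totient d) := by
  set S : Finset ℚ[X] := n.divisors.image (fun d ↦ cyclotomic d ℚ) with hS
  have hinj : Set.InjOn (fun d : ℕ ↦ cyclotomic d ℚ) n.divisors := fun a _ b _ h ↦ cyclotomic_injective h
  have hcop : (S : Set ℚ[X]).Pairwise IsCoprime := by
    intro P hP Q hQ hPQ
    obtain ⟨a, -, rfl⟩ := Finset.mem_image.1 (Finset.mem_coe.1 hP)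
    obtain ⟨b, -, rfl⟩ := Finset.mem_image.1 (Finset.mem_coe.1 hQ)
    exact cyclotomic.isCoprime_rat fun hab ↦ hPQ (by rw [hab])
  have h0 : aeval γ (∏ P ∈ S, P) = 0 := by
    rw [Finset.prod_image hinj, prod_cyclotomic_eq_X_pow_sub_one hn, map_sub, map_pow, aeval_X, map_one, hγ, sub_self]
  -- the tree's primary decomposition is stated with the classical `DecidableEq`; transport the instance
  have hint : DirectSum.IsInternal fun P : S ↦ LinearMap.ker (aeval γ (P : ℚ[X])) := by
    convert Literature.LinearAlgebra.isInternal_ker_aeval γ S hcop h0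
  have hS' : γ.charpoly = ∏ P ∈ S, P ^ (finrank ℚ (LinearMap.ker (aeval γ P)) / P.natDegree) := by
    rw [Literature.LinearAlgebra.charpoly_eq_prod_charpoly_restrict hint (f := γ)
        fun P x hx ↦ Literature.LinearAlgebra.mapsTo_ker_aeval γ P.1 hx, ← Finset.prod_coe_sort S]
    refine Finset.prod_congr rfl fun P _ ↦ ?_
    obtain ⟨d, hd, hdP⟩ := Finset.mem_image.1 P.2
    have hirr : Irreducible (P : ℚ[X]) := hdP ▸ cyclotomic.irreducible_rat (Nat.pos_of_mem_divisors hd)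
    have hmon : (P : ℚ[X]).Monic := hdP ▸ cyclotomic.monic d ℚ
    obtain ⟨m, hm1, hm2, -⟩ := Literature.LinearAlgebra.exists_finrank_charpoly_centralizer_of_irreducible
      (γ.restrict fun _ hx ↦ Literature.LinearAlgebra.mapsTo_ker_aeval γ P.1 hx) hirr hmon
      (Literature.LinearAlgebra.aeval_restrict_ker_eq_zero γ P.1)
    rw [hm2, hm1, Nat.mul_div_cancel _ hirr.natDegree_pos]
  rw [hS', Finset.prod_image hinj]
  exact Finset.prod_congr rfl fun d _ ↦ by rw [natDegree_cyclotomic]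

end Operator

section MatrixLevel

variable {ι : Type*} [Fintype ι] [DecidableEq ι]

/-- `dim_ℚ C(A) = dim_ℚ C(toLin' A)`: the commutant of a matrix and of its linear map have the same dimension
(`toLin'` is an algebra isomorphism). [folklore] -/
private theorem finrank_centralizer_matrix_eq_toLin' (A : Matrix ι ι ℚ) :
    finrank ℚ (Subalgebra.centralizer ℚ ({A} : Set (Matrix ι ι ℚ))) =
      finrank ℚ (Subalgebra.centralizer ℚ ({Matrix.toLin' A} : Set (Module.End ℚ (ι → ℚ)))) := by
  let e : Matrix ι ι ℚ ≃ₐ[ℚ] Module.End ℚ (ι → ℚ) := Matrix.toLinAlgEquiv'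
  have he : ∀ B : Matrix ι ι ℚ, e B = Matrix.toLin' B := fun _ ↦ rfl
  have hmap : (Subalgebra.centralizer ℚ ({A} : Set (Matrix ι ι ℚ))).map (e : Matrix ι ι ℚ →ₐ[ℚ] _) =
      Subalgebra.centralizer ℚ ({Matrix.toLin' A} : Set (Module.End ℚ (ι → ℚ))) := by
    ext Y
    rw [Subalgebra.mem_map, Subalgebra.mem_centralizer_iff]
    constructor
    · rintro ⟨B, hB, rfl⟩ g hg
      rw [Set.mem_singleton_iff.1 hg]
      change e A * e B = e B * e A
      rw [← map_mul, ← map_mul, (Subalgebra.mem_centralizer_iff ℚ).1 hB A (Set.mem_singleton A)]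
    · intro hY
      refine ⟨e.symm Y, (Subalgebra.mem_centralizer_iff ℚ).2 fun g hg ↦ ?_, e.apply_symm_apply Y⟩
      rw [Set.mem_singleton_iff.1 hg]
      apply e.injective
      rw [map_mul, map_mul, e.apply_symm_apply, he]
      exact hY _ (Set.mem_singleton _)
  have key := (e.subalgebraMap (Subalgebra.centralizer ℚ ({A} : Set (Matrix ι ι ℚ)))).toLinearEquiv.finrank_eq
  rw [hmap] at key
  exact key

end MatrixLevel

end CyclotomicIdempotents

/-! ### §2 `ker Φ_d(ρ_r(u)) = Im e_d` has dimension `φ(d) h_d`, and `P^r_u = Π_{d ∣ n} Φ_d^{h_d}` -/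

namespace ComplexTorus

open CyclotomicIdempotents Literature.LinearAlgebra

universe u

variable {ι : Type u} [Fintype ι] [DecidableEq ι] {E : Type*} [NormedAddCommGroup E] [NormedSpace ℂ E]
  {Φ : (ι → ℝ) ≃L[ℝ] E} {n : ℕ} {u : endAlgRat Φ}

section Charpoly

/-- `uⁿ = 1` on `H₁(X, ℚ)`. [folklore] -/
private theorem coe_pow_eq_one (hu : u ^ n = 1) : (u : Matrix ι ι ℚ) ^ n = 1 := by
  rw [← SubmonoidClass.coe_pow, hu, Subalgebra.coe_one]

/-- `ρ_r(u)ⁿ = 1` as a linear map. [folklore] -/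
private theorem toLin'_pow_eq_one (hu : u ^ n = 1) : Matrix.toLin' (u : Matrix ι ι ℚ) ^ n = 1 := by
  rw [← Matrix.toLin'_pow, coe_pow_eq_one hu, Matrix.toLin'_one]
  rfl

/-- `toLin' e_d(u) = e_d(toLin' u)`: the cyclotomic idempotents commute with the passage to linear maps.
[cite: LangeRodriguez2022, §2.9 (2.26) (`ρ : ℚ[G] → End_ℚ(A)` is an algebra homomorphism), p0042] -/
theorem toLin'_cyclicIdempotent (d : ℕ) :
    Matrix.toLin' ((cyclicIdempotent n u d : endAlgRat Φ) : Matrix ι ι ℚ) =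
      cyclicIdempotent n (Matrix.toLin' (u : Matrix ι ι ℚ)) d := by
  rw [cyclicIdempotent, cyclicIdempotent, aeval_subalgebra_coe]
  exact (aeval_algHom_apply (Matrix.toLinAlgEquiv' : Matrix ι ι ℚ ≃ₐ[ℚ] Module.End ℚ (ι → ℚ))
    (u : Matrix ι ι ℚ) (cycIdem n d)).symm

/-- **`dim_ℚ Im e_d(ρ_r(u)) = φ(d) · h_d`** (`= rk Λ(X^{e_d})`, Prop. 2.9.3 (i)). [cite: LangeRodriguez2022, §2.9 Prop. 2.9.3 (i), p0046] -/
theorem finrank_range_cyclicIdempotent_eq (hn : 0 < n) (hu : u ^ n = 1) {d : ℕ} (hd : d ∈ n.divisors) :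
    finrank ℚ (LinearMap.range (cyclicIdempotent n (Matrix.toLin' (u : Matrix ι ι ℚ)) d)) =
      Nat.totient d * cyclicMultiplicity Φ n u d := by
  rw [← toLin'_cyclicIdempotent, ← subRank_idemSubspace_eq_finrank_range (isIdempotentElem_cyclicIdempotent hn hu d),
    subRank_cyclicIdempotent_eq_totient_mul Φ hn hu hd]

/-- **`dim_ℚ ker Φ_d(ρ_r(u)) = φ(d) · h_d`**: the `Φ_d`-primary part of `H₁(X, ℚ)` under `ρ_r(u)` is `Λ(X^{e_d})_ℚ`,
a `ℚ(ζ_d)`-space of dimension `h_d`. [cite: LangeRodriguez2022, §2.9 Prop. 2.9.3 (i), p0046] [cite: DolgachevZarhin2024, §2.2 Remark 2.17 («`Λ_ℚ` is a free module of rank `r` over `ℚ[δ]`»), p0035] -/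
theorem finrank_ker_aeval_cyclotomic_eq (hn : 0 < n) (hu : u ^ n = 1) {d : ℕ} (hd : d ∈ n.divisors) :
    finrank ℚ (LinearMap.ker (aeval (Matrix.toLin' (u : Matrix ι ι ℚ)) (cyclotomic d ℚ))) =
      Nat.totient d * cyclicMultiplicity Φ n u d := by
  rw [ker_aeval_cyclotomic_eq_range_cyclicIdempotent hn (toLin'_pow_eq_one hu) hd,
    finrank_range_cyclicIdempotent_eq hn hu hd]

/-- **`P^r_u = Π_{d ∣ n} Φ_d^{h_d}`** — the rational representation of an endomorphism of finite order is
`ρ_r ≅ ⊕_{d ∣ n} W_d^{h_d}` (`W_d` the irreducible rational representation with character field `ℚ(ζ_d)`); no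
squarefree hypothesis. [cite: LangeRodriguez2022, §2.9 Prop. 2.9.3 («`ρ_r = Σ_j h_j W_j`»), p0046; §6.1.1 Prop. 6.1.2, p0153]
[cite: Milne1999, §7 p. 75 («`f(t) = Π P(t)^{m(P)}`»)] -/
theorem charpoly_coe_eq_prod_cyclotomic_pow (hn : 0 < n) (hu : u ^ n = 1) :
    (u : Matrix ι ι ℚ).charpoly = ∏ d ∈ n.divisors, cyclotomic d ℚ ^ cyclicMultiplicity Φ n u d := by
  rw [← Matrix.charpoly_toLin', charpoly_eq_prod_cyclotomic_pow_finrank_div hn (toLin'_pow_eq_one hu)]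
  refine Finset.prod_congr rfl fun d hd ↦ ?_
  rw [finrank_ker_aeval_cyclotomic_eq hn hu hd,
    Nat.mul_div_cancel_left _ (Nat.totient_pos.2 (Nat.pos_of_mem_divisors hd))]

/-- `h_d = 0 ⟺ d ∉ D` (for `d ∣ n`). [cite: LangeRodriguez2022, §2.9 Prop. 2.9.3 (i), p0046] -/
theorem cyclicMultiplicity_eq_zero_iff_not_mem (hn : 0 < n) (hu : u ^ n = 1) {d : ℕ} (hd : d ∈ n.divisors) :
    cyclicMultiplicity Φ n u d = 0 ↔ d ∉ eigenvalueOrders n u := by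
  rw [← cyclicMultiplicity_ne_zero_iff_mem_eigenvalueOrders Φ hn hu hd, not_not]

/-- `d ∈ D ⟺ h_d ≥ 1`. [cite: CaroccaLangeRodriguez2019, §2.2, p0004] -/
theorem mem_eigenvalueOrders_iff_cyclicMultiplicity_pos (hn : 0 < n) (hu : u ^ n = 1) {d : ℕ} :
    d ∈ eigenvalueOrders n u ↔ 0 < cyclicMultiplicity Φ n u d := by
  constructor
  · intro hd
    exact Nat.pos_of_ne_zero ((cyclicMultiplicity_ne_zero_iff_mem_eigenvalueOrders Φ hn hu (mem_eigenvalueOrders.1 hd).1).2 hd)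
  · intro hpos
    by_cases hdn : d ∈ n.divisors
    · exact (cyclicMultiplicity_ne_zero_iff_mem_eigenvalueOrders Φ hn hu hdn).1 hpos.ne'
    · rw [cyclicMultiplicity_eq_zero_of_not_mem_divisors Φ hn hu hdn] at hpos
      exact absurd hpos (lt_irrefl 0)

/-- **`P^r_u = Π_{d ∈ D} Φ_d^{h_d}`** (the factors off `D` are trivial). [cite: LangeRodriguez2022, §2.9 Prop. 2.9.3, p0046]
[cite: CaroccaLangeRodriguez2019, §2.2 («the orders of the eigenvalues»), p0004] -/
theorem charpoly_coe_eq_prod_cyclotomic_pow_eigenvalueOrders (hn : 0 < n) (hu : u ^ n = 1) :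
    (u : Matrix ι ι ℚ).charpoly = ∏ d ∈ eigenvalueOrders n u, cyclotomic d ℚ ^ cyclicMultiplicity Φ n u d := by
  rw [charpoly_coe_eq_prod_cyclotomic_pow hn hu]
  symm
  refine Finset.prod_subset (fun d hd ↦ (mem_eigenvalueOrders.1 hd).1) fun d hd hnd ↦ ?_
  rw [(cyclicMultiplicity_eq_zero_iff_not_mem hn hu hd).2 hnd, pow_zero]

end Charpoly

/-! ### §3 The commutant: `dim_ℚ C(u) = Σ_{d ∣ n} φ(d) h_d²` (Tate's `r(P^r_u)`) -/

section Commutant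

/-- **`dim_ℚ C(u) = Σ_{d ∣ n} φ(d) h_d²`** — the commutant `C(u) = End_{ℚ[u]}(H₁(X, ℚ)) ≅ Π_d Mat_{h_d}(ℚ(ζ_d))` of an
endomorphism of finite order has dimension Tate's `r(P^r_u)` (Dolgachev–Zarhin's `End_{ℚ[δ]}(Λ_ℚ) = Mat_r(ℚ[δ])`
for every finite order at once). [cite: Tate1966Endomorphisms, p. 138] [cite: Milne1999, §7 p. 75 L7–L9]
[cite: DolgachevZarhin2024, §2.2 Remark 2.17, p0035] -/
theorem finrank_centralizer_coe_eq_sum_sq (hn : 0 < n) (hu : u ^ n = 1) :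
    finrank ℚ (Subalgebra.centralizer ℚ ({(u : Matrix ι ι ℚ)} : Set (Matrix ι ι ℚ))) =
      ∑ d ∈ n.divisors, Nat.totient d * cyclicMultiplicity Φ n u d ^ 2 := by
  rw [finrank_centralizer_matrix_eq_toLin',
    finrank_centralizer_eq_tateR_of_charpoly_eq _ (isSemisimple_of_pow_eq_one' hn (toLin'_pow_eq_one hu))
      (f := ∏ d ∈ n.divisors, cyclotomic d ℚ ^ cyclicMultiplicity Φ n u d)
      (by rw [Matrix.charpoly_toLin', charpoly_coe_eq_prod_cyclotomic_pow hn hu]),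
    tateR_finset_prod_pow _ _ _ (fun d hd ↦ cyclotomic.irreducible_rat (Nat.pos_of_mem_divisors hd))
      (fun d _ ↦ cyclotomic.monic d ℚ) (fun a _ b _ h ↦ cyclotomic_injective h)]
  exact Finset.sum_congr rfl fun d _ ↦ by rw [natDegree_cyclotomic, mul_comm]

/-- `dim_ℚ C(u) = Σ_{d ∈ D} φ(d) h_d²`. [cite: Tate1966Endomorphisms, p. 138] [cite: DolgachevZarhin2024, §2.2 Remark 2.17, p0035] -/
theorem finrank_centralizer_coe_eq_sum_sq_eigenvalueOrders (hn : 0 < n) (hu : u ^ n = 1) :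
    finrank ℚ (Subalgebra.centralizer ℚ ({(u : Matrix ι ι ℚ)} : Set (Matrix ι ι ℚ))) =
      ∑ d ∈ eigenvalueOrders n u, Nat.totient d * cyclicMultiplicity Φ n u d ^ 2 := by
  rw [finrank_centralizer_coe_eq_sum_sq hn hu]
  symm
  refine Finset.sum_subset (fun d hd ↦ (mem_eigenvalueOrders.1 hd).1) fun d hd hnd ↦ ?_
  rw [(cyclicMultiplicity_eq_zero_iff_not_mem hn hu hd).2 hnd]
  simp

/-- **`2 dim X ≤ dim_ℚ C(u)`** (`deg P^r_u ≤ r(P^r_u)`). [cite: Tate1966Endomorphisms, p. 138] [cite: Milne1999, §7 p. 75] -/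
theorem card_le_finrank_centralizer_coe (hn : 0 < n) (hu : u ^ n = 1) :
    Fintype.card ι ≤ finrank ℚ (Subalgebra.centralizer ℚ ({(u : Matrix ι ι ℚ)} : Set (Matrix ι ι ℚ))) := by
  rw [finrank_centralizer_matrix_eq_toLin', ← Module.finrank_fintype_fun_eq_card (R := ℚ) (η := ι)]
  exact finrank_le_finrank_centralizer _ (isSemisimple_of_pow_eq_one' hn (toLin'_pow_eq_one hu))

/-- `dim_ℚ C(u) ≤ (2 dim X)²`. [cite: Tate1966Endomorphisms, p. 138] [cite: DolgachevZarhin2024, §2.2 Remark 2.17 («`d ≤ r²`»), p0035] -/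
theorem finrank_centralizer_coe_le_card_sq (hn : 0 < n) (hu : u ^ n = 1) :
    finrank ℚ (Subalgebra.centralizer ℚ ({(u : Matrix ι ι ℚ)} : Set (Matrix ι ι ℚ))) ≤ Fintype.card ι ^ 2 := by
  rw [finrank_centralizer_matrix_eq_toLin', ← Module.finrank_fintype_fun_eq_card (R := ℚ) (η := ι)]
  exact finrank_centralizer_le_finrank_sq _ (isSemisimple_of_pow_eq_one' hn (toLin'_pow_eq_one hu))

/-- **`dim_ℚ C(u) = 2 dim X ⟺ P^r_u` is squarefree** — the dimension form of the generation-27 criterion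
`C(u) = ℚ[u]` (Tate: `r(f) = deg f` iff no repeated factor). [cite: Tate1966Endomorphisms, p. 138] [cite: Milne1999, §7 p. 75 L7–L9]
[cite: DolgachevZarhin2024, §2.2 Thm. 2.18, p0036] -/
theorem finrank_centralizer_coe_eq_card_iff_squarefree (hn : 0 < n) (hu : u ^ n = 1) :
    finrank ℚ (Subalgebra.centralizer ℚ ({(u : Matrix ι ι ℚ)} : Set (Matrix ι ι ℚ))) = Fintype.card ι ↔
      Squarefree (u : Matrix ι ι ℚ).charpoly := by
  rw [finrank_centralizer_matrix_eq_toLin', ← Module.finrank_fintype_fun_eq_card (R := ℚ) (η := ι),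
    finrank_centralizer_eq_finrank_iff _ (isSemisimple_of_pow_eq_one' hn (toLin'_pow_eq_one hu)), Matrix.charpoly_toLin']

/-- `dim_ℚ C(u) = 2 dim X ⟺` every multiplicity `h_d ≤ 1`. [cite: LangeRodriguez2022, §2.9 Prop. 2.9.3 and §6.1.1 Prop. 6.1.2, p0046, p0153]
[cite: Tate1966Endomorphisms, p. 138] -/
theorem finrank_centralizer_coe_eq_card_iff_forall_le_one (hn : 0 < n) (hu : u ^ n = 1) :
    finrank ℚ (Subalgebra.centralizer ℚ ({(u : Matrix ι ι ℚ)} : Set (Matrix ι ι ℚ))) = Fintype.card ι ↔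
      ∀ d ∈ n.divisors, cyclicMultiplicity Φ n u d ≤ 1 := by
  rw [finrank_centralizer_coe_eq_card_iff_squarefree hn hu,
    squarefree_charpoly_coe_iff_forall_cyclicMultiplicity_le_one Φ hn hu]

/-- **`dim_ℚ End_ℚ(X)_u ≤ Σ_{d ∣ n} φ(d) h_d²`** for the `u`-equivariant endomorphisms `End_ℚ(X)_u = End_ℚ(X) ∩ C(u)` —
Dolgachev–Zarhin's embedding `End_ℚ(A)_δ ↪ End_{ℚ[δ]}(Λ_ℚ)` and bound `d ≤ r²` (`[ℚ(ζ):ℚ] r²` over `ℚ`), for every finite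
order. [cite: DolgachevZarhin2024, §2.2 Remark 2.17, p0035] -/
theorem finrank_endAlgRat_inf_centralizer_le (hn : 0 < n) (hu : u ^ n = 1) :
    finrank ℚ ↥(endAlgRat Φ ⊓ Subalgebra.centralizer ℚ ({(u : Matrix ι ι ℚ)} : Set (Matrix ι ι ℚ))) ≤
      ∑ d ∈ n.divisors, Nat.totient d * cyclicMultiplicity Φ n u d ^ 2 := by
  rw [← finrank_centralizer_coe_eq_sum_sq hn hu, ← Subalgebra.finrank_toSubmodule, ← Subalgebra.finrank_toSubmodule]
  exact Submodule.finrank_mono (Subalgebra.toSubmodule.le_iff_le.2 inf_le_right)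

end Commutant

/-! ### §4 Fixed points of an endomorphism of finite order in general: `#X^δ = Π_{d ∈ D} Φ_d(1)^{h_d}` -/

section FixedPoints

variable {D : Matrix ι ι ℤ}

/-- `Φ_d(1)` in `ℚ` is the integer `Φ_d(1)`. [folklore] -/
private theorem eval_one_cyclotomic_rat_eq_intCast' (d : ℕ) :
    (cyclotomic d ℚ).eval 1 = (((cyclotomic d ℤ).eval 1 : ℤ) : ℚ) := by
  rw [← map_cyclotomic_int d ℚ, eval_one_map, eq_intCast]

/-- `Φ_d(1)` as an integer for `d ≥ 2`: `ℓ` if `d` is a power of the prime `ℓ`, `1` otherwise. [folklore] -/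
private theorem eval_one_cyclotomic_int_eq_ite' {d : ℕ} (hd : 2 ≤ d) :
    (cyclotomic d ℤ).eval 1 = if IsPrimePow d then (d.minFac : ℤ) else 1 := by
  split_ifs with h
  · obtain ⟨p, k, hp, hk, rfl⟩ := (isPrimePow_nat_iff _).1 h
    obtain ⟨k, rfl⟩ := Nat.exists_eq_succ_of_ne_zero hk.ne'
    haveI := Fact.mk hp
    rw [eval_one_cyclotomic_prime_pow, hp.pow_minFac (Nat.succ_ne_zero k)]
  · refine eval_one_cyclotomic_not_prime_pow fun {p} hp k hk ↦ ?_
    rcases k.eq_zero_or_pos with rfl | hk0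
    · rw [pow_zero] at hk; omega
    · exact h ⟨p, k, hp.prime, hk0, hk⟩

/-- `Φ_d(1) > 0` for `d ≥ 2`. [folklore] -/
private theorem eval_one_cyclotomic_int_pos {d : ℕ} (hd : 2 ≤ d) : 0 < (cyclotomic d ℤ).eval 1 := by
  rw [eval_one_cyclotomic_int_eq_ite' hd]
  split_ifs
  · exact_mod_cast Nat.minFac_pos d
  · exact one_pos

/-- **`det(1 − ρ_r(δ)) = Π_{d ∣ n} Φ_d(1)^{h_d}`** for an endomorphism `δ = ρ(D)` with `u = D_ℚ`, `uⁿ = 1`.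
[cite: AlvaradoAuffarth2018, §3 («`F(n) = Δ_n(χ^r_f)`»), p0006] [cite: DolgachevZarhin2024, §2.2 (2.15), p0034] -/
theorem det_one_sub_eq_prod_eval_one_pow (hD : (u : Matrix ι ι ℚ) = D.map (Int.cast : ℤ → ℚ)) (hn : 0 < n)
    (hu : u ^ n = 1) : (1 - D).det = ∏ d ∈ n.divisors, (cyclotomic d ℤ).eval 1 ^ cyclicMultiplicity Φ n u d := by
  have h : (((1 - D).det : ℤ) : ℚ) =
      ((∏ d ∈ n.divisors, (cyclotomic d ℤ).eval 1 ^ cyclicMultiplicity Φ n u d : ℤ) : ℚ) := by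
    rw [intCast_det_one_sub_eq_eval_one hD, charpoly_coe_eq_prod_cyclotomic_pow hn hu, eval_prod, Int.cast_prod]
    refine Finset.prod_congr rfl fun d _ ↦ ?_
    rw [eval_pow, Int.cast_pow, eval_one_cyclotomic_rat_eq_intCast']
  exact_mod_cast h

/-- **`#X^δ = |Π_{d ∣ n} Φ_d(1)^{h_d}|`** (as `Nat.card`, `0` iff infinite). [cite: DolgachevZarhin2024, §2.2 (2.15) («`A^δ ≅ Λ/(1 − δ)Λ`»), p0034]
[cite: AlvaradoAuffarth2018, §3, p0006] [cite: LangeBirkenhake1992, Ch. 13 §1] -/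
theorem intCast_natCard_fixedSubgroup_eq_abs_prod (hD : (u : Matrix ι ι ℚ) = D.map (Int.cast : ℤ → ℚ)) (hn : 0 < n)
    (hu : u ^ n = 1) :
    (Nat.card (fixedSubgroup Φ D) : ℤ) = |∏ d ∈ n.divisors, (cyclotomic d ℤ).eval 1 ^ cyclicMultiplicity Φ n u d| := by
  rw [natCard_fixedSubgroup Φ D, Int.natCast_natAbs, det_one_sub_eq_prod_eval_one_pow hD hn hu]

/-- **`#X^δ = 0` (infinitely many fixed points) `⟺ 1 ∈ D`** (`δ` has the eigenvalue `1` on `H₁`; `h_1 = dim (X^δ)⁰ > 0`).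
[cite: DolgachevZarhin2024, §2.2 (2.17) («`1` is not an eigenvalue»), p0034] [cite: AlvaradoAuffarth2018, Thm. 1.1 (3), p0003] -/
theorem natCard_fixedSubgroup_eq_zero_iff_one_mem (hD : (u : Matrix ι ι ℚ) = D.map (Int.cast : ℤ → ℚ)) (hn : 0 < n)
    (hu : u ^ n = 1) : Nat.card (fixedSubgroup Φ D) = 0 ↔ 1 ∈ eigenvalueOrders n u := by
  rw [mem_eigenvalueOrders_iff_cyclotomic_dvd_charpoly hn hu, natCard_fixedSubgroup Φ D, Int.natAbs_eq_zero,
    cyclotomic_one, ← C_1, dvd_iff_isRoot, IsRoot.def, ← intCast_det_one_sub_eq_eval_one hD, Int.cast_eq_zero]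
  exact ⟨fun h ↦ ⟨Nat.one_mem_divisors.2 hn.ne', h⟩, fun h ↦ h.2⟩

/-- `d ≥ 2` for `d ∈ D` when `1 ∉ D`. [folklore] -/
private theorem two_le_of_mem_of_one_not_mem (h1 : 1 ∉ eigenvalueOrders n u) {d : ℕ} (hd : d ∈ eigenvalueOrders n u) :
    2 ≤ d := by
  have hd1 : 1 ≤ d := Nat.pos_of_mem_divisors (mem_eigenvalueOrders.1 hd).1
  rcases hd1.eq_or_lt with h | h
  · exact absurd (h ▸ hd) h1
  · exact h

/-- **`#X^δ = Π_{d ∈ D} Φ_d(1)^{h_d}` when `1 ∉ D`** (every factor positive). [cite: DolgachevZarhin2024, §2.2 (2.15), p0034]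
[cite: AlvaradoAuffarth2018, §3, p0006] -/
theorem natCard_fixedSubgroup_eq_prod_pow (hD : (u : Matrix ι ι ℚ) = D.map (Int.cast : ℤ → ℚ)) (hn : 0 < n)
    (hu : u ^ n = 1) (h1 : 1 ∉ eigenvalueOrders n u) :
    (Nat.card (fixedSubgroup Φ D) : ℤ) = ∏ d ∈ eigenvalueOrders n u, (cyclotomic d ℤ).eval 1 ^ cyclicMultiplicity Φ n u d := by
  have hprod : ∏ d ∈ n.divisors, (cyclotomic d ℤ).eval 1 ^ cyclicMultiplicity Φ n u d =
      ∏ d ∈ eigenvalueOrders n u, (cyclotomic d ℤ).eval 1 ^ cyclicMultiplicity Φ n u d := by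
    symm
    refine Finset.prod_subset (fun d hd ↦ (mem_eigenvalueOrders.1 hd).1) fun d hd hnd ↦ ?_
    rw [(cyclicMultiplicity_eq_zero_iff_not_mem hn hu hd).2 hnd, pow_zero]
  rw [intCast_natCard_fixedSubgroup_eq_abs_prod hD hn hu, hprod]
  exact abs_of_pos (Finset.prod_pos fun d hd ↦ pow_pos (eval_one_cyclotomic_int_pos (two_le_of_mem_of_one_not_mem h1 hd)) _)

open scoped Classical in
/-- **`#X^δ = Π_{d ∈ D, d a prime power} ℓ_d^{h_d}`** (`ℓ_d` the prime under `d`) when `1 ∉ D` — the general form of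
Dolgachev–Zarhin's `#A^δ = ℓ^r` (`D = {ℓ}`, `h_ℓ = r = 2 dim A/(ℓ−1)`). [cite: DolgachevZarhin2024, §2.2 (2.15) («`#A^δ = ℓ^{2dim A/(ℓ−1)}`»), p0034] -/
theorem natCard_fixedSubgroup_eq_prod_minFac_pow (hD : (u : Matrix ι ι ℚ) = D.map (Int.cast : ℤ → ℚ)) (hn : 0 < n)
    (hu : u ^ n = 1) (h1 : 1 ∉ eigenvalueOrders n u) :
    Nat.card (fixedSubgroup Φ D) =
      ∏ d ∈ (eigenvalueOrders n u).filter IsPrimePow, d.minFac ^ cyclicMultiplicity Φ n u d := by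
  have h := natCard_fixedSubgroup_eq_prod_pow hD hn hu h1
  rw [Finset.prod_filter]
  have h' : (Nat.card (fixedSubgroup Φ D) : ℤ) =
      ((∏ d ∈ eigenvalueOrders n u, (if IsPrimePow d then d.minFac ^ cyclicMultiplicity Φ n u d else 1 : ℕ) : ℕ) : ℤ) := by
    rw [h, Nat.cast_prod]
    refine Finset.prod_congr rfl fun d hd ↦ ?_
    rw [eval_one_cyclotomic_int_eq_ite' (two_le_of_mem_of_one_not_mem h1 hd)]
    split_ifs <;> simp
  exact_mod_cast h'

/-- **`ℓ ∣ #X^δ ⟺ ℓ^j ∈ D` for some `j ≥ 1`** (`ℓ` prime, `1 ∉ D`). [cite: DolgachevZarhin2024, §2.2 (2.15)–(2.16) («`A^δ ⊆ A[ℓ]`»), p0034] -/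
theorem prime_dvd_natCard_fixedSubgroup_iff' (hD : (u : Matrix ι ι ℚ) = D.map (Int.cast : ℤ → ℚ)) (hn : 0 < n)
    (hu : u ^ n = 1) (h1 : 1 ∉ eigenvalueOrders n u) {p : ℕ} (hp : p.Prime) :
    p ∣ Nat.card (fixedSubgroup Φ D) ↔ ∃ k : ℕ, p ^ (k + 1) ∈ eigenvalueOrders n u := by
  classical
  rw [natCard_fixedSubgroup_eq_prod_minFac_pow hD hn hu h1, (Nat.prime_iff.1 hp).dvd_finsetProd_iff]
  simp only [Finset.mem_filter]
  constructor
  · rintro ⟨d, ⟨hd, hpp⟩, hdvd⟩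
    obtain ⟨q, k, hq, hk, rfl⟩ := (isPrimePow_nat_iff _).1 hpp
    obtain ⟨k, rfl⟩ := Nat.exists_eq_succ_of_ne_zero hk.ne'
    rw [hq.pow_minFac (Nat.succ_ne_zero k)] at hdvd
    rw [(Nat.prime_dvd_prime_iff_eq hp hq).1 (hp.dvd_of_dvd_pow hdvd)]
    exact ⟨k, hd⟩
  · rintro ⟨k, hk⟩
    have hpos : 0 < cyclicMultiplicity Φ n u (p ^ (k + 1)) := (mem_eigenvalueOrders_iff_cyclicMultiplicity_pos hn hu).1 hk
    refine ⟨p ^ (k + 1), ⟨hk, hp.isPrimePow.pow (Nat.succ_ne_zero k)⟩, ?_⟩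
    rw [hp.pow_minFac (Nat.succ_ne_zero k)]
    exact dvd_pow_self p hpos.ne'

end FixedPoints

/-! ### §5 Instance: `(i, i)` on `E_i × E_i` — `D = {4}`, `h_4 = 2`, `P^r = Φ_4²`, `dim C = 8`, `#Fix = 4` -/

section GaussSquare

variable (hI : Complex.I.im ≠ 0)

/-- `Φ_d ∣ Φ_4² ⟹ d = 4` (`d > 0`). [folklore] -/
private theorem eq_four_of_cyclotomic_dvd_sq {d : ℕ} (hd : 0 < d) (h : cyclotomic d ℚ ∣ cyclotomic 4 ℚ ^ 2) : d = 4 := by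
  have h4 := (cyclotomic.irreducible_rat hd).prime.dvd_of_dvd_pow h
  exact cyclotomic_injective (eq_of_monic_of_associated (cyclotomic.monic d ℚ) (cyclotomic.monic 4 ℚ)
    ((cyclotomic.irreducible_rat hd).associated_of_dvd (cyclotomic.irreducible_rat (by norm_num)) h4))

/-- `P^r(i, i) = Φ_4²` (FILE 3's `(x² + 1)²`). [cite: DolgachevZarhin2024, §2.2 Thm. 2.18 (second alternative, `r = 2`), p0036] -/
private theorem charpoly_gaussSq_eq_cyclotomic_four_sq :
    (Matrix.fromBlocks gaussJ 0 0 gaussJ).charpoly = cyclotomic 4 ℚ ^ 2 := by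
  rw [← charpoly_gaussJ, Matrix.charpoly_fromBlocks_zero₁₂, pow_two]

/-- **`E_i × E_i`, `(i, i)`: `D = {4}`** (`P^r = Φ_4²`). [cite: CaroccaLangeRodriguez2019, §2.2, p0004] -/
theorem eigenvalueOrders_gaussSq :
    eigenvalueOrders 4 (⟨Matrix.fromBlocks gaussJ 0 0 gaussJ, gaussSq_mem_endAlgRat hI⟩ :
      endAlgRat (prodPeriod (ellipticPeriod hI) (ellipticPeriod hI))) = {4} := by
  ext d
  rw [mem_eigenvalueOrders_iff_cyclotomic_dvd_charpoly (by norm_num) (gaussSqEnd_pow_four hI), Finset.mem_singleton]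
  change d ∈ Nat.divisors 4 ∧ cyclotomic d ℚ ∣ (Matrix.fromBlocks gaussJ 0 0 gaussJ).charpoly ↔ d = 4
  rw [charpoly_gaussSq_eq_cyclotomic_four_sq]
  constructor
  · rintro ⟨hd, hdvd⟩
    exact eq_four_of_cyclotomic_dvd_sq (Nat.pos_of_mem_divisors hd) hdvd
  · rintro rfl
    exact ⟨by decide, dvd_pow_self _ two_ne_zero⟩

/-- **`E_i × E_i`, `(i, i)`: the multiplicity `h_4 = 2`** (`φ(4) h_4 = rk Λ = 4`; `ρ_r = W_4²`, Dolgachev–Zarhin's `r = 2`).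
[cite: DolgachevZarhin2024, §2.2 Thm. 2.18 (`A ∼ B^r`, `r = 2`), p0036] [cite: LangeRodriguez2022, §2.9 Prop. 2.9.3 (i), p0046] -/
theorem cyclicMultiplicity_gaussSq_four :
    cyclicMultiplicity (prodPeriod (ellipticPeriod hI) (ellipticPeriod hI)) 4
      (⟨Matrix.fromBlocks gaussJ 0 0 gaussJ, gaussSq_mem_endAlgRat hI⟩ :
        endAlgRat (prodPeriod (ellipticPeriod hI) (ellipticPeriod hI))) 4 = 2 := by
  have h := sum_totient_mul_cyclicMultiplicity_eigenvalueOrders (prodPeriod (ellipticPeriod hI) (ellipticPeriod hI))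
    (by norm_num) (gaussSqEnd_pow_four hI)
  rw [eigenvalueOrders_gaussSq, Finset.sum_singleton, Fintype.card_sum, Fintype.card_fin,
    show Nat.totient 4 = 2 by decide] at h
  omega

/-- `P^r(i, i) = Φ_4^{h_4} = Φ_4²`, recovered from §2. [cite: LangeRodriguez2022, §2.9 Prop. 2.9.3 («`ρ_r = Σ h_j W_j`»), p0046] -/
theorem charpoly_gaussSq_eq_cyclotomic_pow_cyclicMultiplicity :
    (Matrix.fromBlocks gaussJ 0 0 gaussJ).charpoly =
      cyclotomic 4 ℚ ^ cyclicMultiplicity (prodPeriod (ellipticPeriod hI) (ellipticPeriod hI)) 4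
        (⟨Matrix.fromBlocks gaussJ 0 0 gaussJ, gaussSq_mem_endAlgRat hI⟩ :
          endAlgRat (prodPeriod (ellipticPeriod hI) (ellipticPeriod hI))) 4 := by
  have h := charpoly_coe_eq_prod_cyclotomic_pow_eigenvalueOrders (by norm_num) (gaussSqEnd_pow_four hI)
  rw [eigenvalueOrders_gaussSq, Finset.prod_singleton] at h
  exact h

/-- **`dim_ℚ C(i, i) = φ(4) · h_4² = 8 = dim_ℚ M₂(ℚ(i))`** (generation 22: `C(i, i) = M₂(ℚ(i)) ⊋ ℚ[(i,i)]`).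
[cite: DolgachevZarhin2024, §2.2 Remark 2.17 and Thm. 2.18 (`End_ℚ(A)_δ ≅ Mat_2(ℚ(i))`), p0035–p0036] [cite: Tate1966Endomorphisms, p. 138] -/
theorem finrank_centralizer_gaussSq :
    finrank ℚ (Subalgebra.centralizer ℚ ({Matrix.fromBlocks gaussJ 0 0 gaussJ} :
      Set (Matrix (Fin 2 ⊕ Fin 2) (Fin 2 ⊕ Fin 2) ℚ))) = 8 := by
  have h := finrank_centralizer_coe_eq_sum_sq_eigenvalueOrders (by norm_num) (gaussSqEnd_pow_four I_im_ne_zero)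
  rw [eigenvalueOrders_gaussSq I_im_ne_zero, Finset.sum_singleton, cyclicMultiplicity_gaussSq_four I_im_ne_zero,
    show Nat.totient 4 = 2 by decide] at h
  exact h

/-- `(R_i 0; 0 R_i) ⊗ ℚ = (J 0; 0 J)`. [folklore] -/
private theorem fromBlocks_rotI_map_intCast :
    (Matrix.fromBlocks rotI 0 0 rotI).map (Int.cast : ℤ → ℚ) = Matrix.fromBlocks gaussJ 0 0 gaussJ := by
  have hr : rotI.map (Int.cast : ℤ → ℚ) = gaussJ := by
    ext i j
    fin_cases i <;> fin_cases j <;> simp [rotI, gaussJ]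
  rw [Matrix.fromBlocks_map, hr, Matrix.map_zero _ Int.cast_zero]

/-- **`#Fix(i, i) = Φ_4(1)^{h_4} = 2² = 4` on `E_i × E_i`** (the non-squarefree count: `(E_i × E_i)^{(i,i)} = E_i^{i} × E_i^{i}`).
[cite: DolgachevZarhin2024, §2.2 (2.15) («`#A^δ = ℓ^{2dim A/(ℓ−1)}`», `ℓ = 2`? no: `Φ_4`, `Φ_4(1) = 2`), p0034] [cite: LangeBirkenhake1992, Ch. 13 §1] -/
theorem natCard_fixedSubgroup_gaussSq :
    Nat.card (fixedSubgroup (prodPeriod (ellipticPeriod hI) (ellipticPeriod hI)) (Matrix.fromBlocks rotI 0 0 rotI)) = 4 := by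
  have h1 : 1 ∉ eigenvalueOrders 4 (⟨Matrix.fromBlocks gaussJ 0 0 gaussJ, gaussSq_mem_endAlgRat hI⟩ :
      endAlgRat (prodPeriod (ellipticPeriod hI) (ellipticPeriod hI))) := by
    rw [eigenvalueOrders_gaussSq]; decide
  have h := natCard_fixedSubgroup_eq_prod_minFac_pow (Φ := prodPeriod (ellipticPeriod hI) (ellipticPeriod hI))
    (u := ⟨Matrix.fromBlocks gaussJ 0 0 gaussJ, gaussSq_mem_endAlgRat hI⟩) fromBlocks_rotI_map_intCast.symm (by norm_num)
    (gaussSqEnd_pow_four hI) h1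
  have h4 : IsPrimePow (4 : ℕ) := by
    have := Nat.prime_two.isPrimePow.pow two_ne_zero
    norm_num at this
    exact this
  rw [h, eigenvalueOrders_gaussSq, Finset.filter_singleton, if_pos h4, Finset.prod_singleton,
    cyclicMultiplicity_gaussSq_four]
  norm_num

end GaussSquare

end ComplexTorus

end Literature.Geometry.Kaehler
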